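import Literature.NumberTheory.Sieve.IwaniecAlmostPrimesProp2
import Literature.NumberTheory.Sieve.IwaniecAlmostPrimesProp1Corollary
import Literature.NumberTheory.Sieve.IwaniecAlmostPrimesMertens
import Literature.NumberTheory.Sieve.IwaniecAlmostPrimesConclusion
import HarnessLib

/-!
# Iwaniec (1978), Proposition 2 (lower bound, constant level) and parity.S19 from Lemma 2 and Proposition 1 — PROVED

H. Iwaniec, *Almost-primes represented by quadratic polynomials*, Invent. Math. **47** (1978)
171–188, Proposition 2 (p. 185): "A similar result holds for lower bound, the function `F(s)`
being replaced by `f(s)`" [cite: IwaniecInventiones1978, Proposition 2].  This is the sequel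
announced in `IwaniecAlmostPrimesProp2.lean`: it PROVES

* `proposition2_lower_const_of : lemma2_bilinearSieve → proposition1_corollary → hK → hM2 →
   proposition2_lower_const` — the lower half of Proposition 2 at a constant sieving level
  `z ≤ Z < x^{1/2}` (`proposition2_lower_const`, `IwaniecAlmostPrimesWeightedSum.lean`), which is
  the only form of the lower bound that §6 uses (through `S(𝒜, z)`, i.e. `q = 1`, `Z = z`);

and then assembles the whole paper below Proposition 2:

* `proposition2_upper_of_lemma2_of_proposition1 : lemma2_bilinearSieve → proposition1 →
   proposition2_upper`, `proposition2_lower_const_of_lemma2_of_proposition1` (feeding the PROVED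
  Corollary of Proposition 1, `proposition1_corollary_of`, and the PROVED Mertens inputs
  `rho_sieveConditionOne`, `exists_sum_rho_div_filter_le`);
* `weightedSum_lower_of_lemma2_of_proposition1 : lemma2_bilinearSieve → proposition1 →
   weightedSum_lower` (display (2), p. 173, at `z = x^{1/5}`);
* **`setOf_isAtMostAlmostPrime_two_sq_add_one_infinite_of_lemma2_of_proposition1 :
   lemma2_bilinearSieve → proposition1 → parity.S19`**.

So after this file `Literature.NumberTheory.Sieve.setOf_isAtMostAlmostPrime_two_sq_add_one_infinite`
(Iwaniec's Theorem for `n² + 1`) rests on exactly two named inputs: Iwaniec's linear sieve with the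
bilinear form of the remainder term (`lemma2_bilinearSieve` = Acta Arith. 37 (1980), Theorem 1) and
the dispersion estimate `proposition1` (p. 176; ⇐ a corrected Lemma 4 ⇐ Lemma 5 (proved,
`IwaniecAlmostPrimesGauss.lean`), Lemma 6 = Hooley's bound for incomplete Kloosterman sums
(⇐ `Literature.NumberTheory.LFunctions.weil_kloosterman_bound`), Lemma 7); everything else in the
paper is proved in the tree.

Proof of the lower bound (pp. 185–186, constant level).  With the parameters of the upper bound
(`ε' = ε/1000`, `ε₂ = ε/4`, `N = x^{1/15−ε'}`, `M = x^{1−4ε'}/2^{i+1}` on the dyadic class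
`2^i ≤ q < 2^{i+1}`), for each `q ∈ Q` with `ρ(q) > 0`:
* if `Z ≤ (MN)^{1/2}`, Lemma 2 (lower bound, `lemma2_multisetAq`) is applied to `ℬ = 𝒜_q` at the
  level `Z` itself: `S(𝒜_q, Z) ≥ V(Z) X (f(log MN/log Z) − E) − R⁻`, and the main term is compared
  with the target by `main_term_lower` and `densityProd_level_le` (`E = O(ε)` by
  `eventually_E_small`);
* if `Z > (MN)^{1/2}` (then `s = log(y/q)/log Z` is within `O(ε')` of `2`, where `f` vanishes),
  the claimed main term is nonpositive (`main_term_lower_trivial`) and `S(𝒜_q, Z) ≥ 0` suffices.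
The remainders `R⁻` are grouped by the dyadic class of `q` (at most `⌊log₂ x⌋ + 1` classes, all at
the common level `Z`); in a class the pairs `(q, m)` inject into `m' = qm < x^{1−4ε'}`
(`abs_remainder_class_le`), so the Corollary of Proposition 1 bounds each of the `< exp(8ε₂⁻³)`
bilinear forms by `C(ε') x^{1−ε'}`, and the total is `≤ ε V(z) x` for large `x`
(`eventually_classes_remainder_le`).  Summing the main terms with `∑ c_q ρ(q)/q ≤ e²/γ`
(`eventually_sum_rough_rho_div_le`) gives the constant `C_γ = (L_f/γ + f_max + c₀(1/γ + 33)) e²/γ + 1`.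

## References

* H. Iwaniec, Invent. Math. 47 (1978) 171–188, Proposition 2 and §6 (`IwaniecInventiones1978`).
* H. Iwaniec, Acta Arith. 37 (1980) 307–320, Theorem 1 (`IwaniecActaArith1980b`).
-/

open Finset Real Polynomial Filter
open scoped Topology

noncomputable section

namespace Literature.NumberTheory.Sieve.Iwaniec1978

/-! ### Proposition 2, lower bound at a constant level, from Lemma 2 and the Corollary of Proposition 1 -/

set_option maxHeartbeats 800000 in
/-- **Proposition 2 (lower bound, constant sieving level) from Lemma 2 and the Corollary of
Proposition 1 — PROVED** (p. 185: "A similar result holds for lower bound, the function `F(s)`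
being replaced by `f(s)`"), given condition (1) for `ρ` (`hK`) and the tail form of Mertens II for
`ρ` (`hM2`), both proved in `IwaniecAlmostPrimesMertens.lean`.  Every `q` with
`Z ≤ (MN)^{1/2}` is sieved by Lemma 2 at the level `Z`; for `Z > (MN)^{1/2}` the main term is
nonpositive and `S(𝒜_q, Z) ≥ 0` is used. [cite: IwaniecInventiones1978, Proposition 2] -/
theorem proposition2_lower_const_of (h2 : lemma2_bilinearSieve) (h1c : proposition1_corollary)
    (hK : ∃ K : ℝ, 1 ≤ K ∧ ∀ w z : ℝ, 2 ≤ w → w < z →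
      ∏ p ∈ (Nat.primesBelow ⌈z⌉₊).filter (fun p : ℕ => w ≤ (p : ℝ)), (1 - (rho p : ℝ) / p)⁻¹ ≤
        Real.log z / Real.log w * (1 + K / Real.log w))
    (hM2 : ∃ C₂ : ℝ, ∀ w z : ℝ, 2 ≤ w → w < z →
      ∑ p ∈ (Nat.primesBelow ⌈z⌉₊).filter (fun p : ℕ => w ≤ (p : ℝ)), (rho p : ℝ) / p ≤
        Real.log (Real.log z / Real.log w) + C₂ / Real.log w) :
    proposition2_lower_const := by
  intro F f hFf γ hγ hγ2
  -- constants depending on `γ` and `f`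
  obtain ⟨c₀, K, hc₀, hK1, HL2⟩ := lemma2_multisetAq h2 hK
  obtain ⟨Lf, hLip⟩ := hFf.exists_lipschitzOnWith_lower (a := 1 / 10) (b := 16 / (15 * γ) + 2)
    (by norm_num)
  obtain ⟨fmax, hfmax⟩ := hFf.exists_bound_lower (a := 1 / 10) (b := 16 / (15 * γ) + 2)
    (by norm_num)
  set Cf : ℝ := Lf / γ + fmax with hCf
  set C₄ : ℝ := 1 / γ + 33 with hC₄
  set Rγ : ℝ := Real.exp 2 / γ with hRγ
  have hfmax0 : 0 ≤ fmax := by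
    have h2mem : (2 : ℝ) ∈ Set.Icc (1 / 10 : ℝ) (16 / (15 * γ) + 2) :=
      ⟨by norm_num, by linarith [show (0 : ℝ) < 16 / (15 * γ) by positivity]⟩
    exact (abs_nonneg _).trans (hfmax 2 h2mem)
  have hCf0 : 0 ≤ Cf := by positivity
  have hC₄0 : 0 < C₄ := by positivity
  have hRγ0 : 0 < Rγ := by positivity
  refine ⟨(Cf + c₀ * C₄) * Rγ + 1, fun ε hε => ?_⟩
  -- the case `ε ≥ 1` is vacuous (no `q` with `1 ≤ q < x^{1−ε} ≤ 1`)
  rcases le_or_gt 1 ε with hε1 | hε1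
  · refine ⟨1, fun x hx Z c hZ hc => ?_⟩
    dsimp only
    have hempty : Finset.Ico 1 ⌈x ^ (1 - ε)⌉₊ = ∅ := by
      have h1 : x ^ (1 - ε) ≤ 1 := Real.rpow_le_one_of_one_le_of_nonpos hx (by linarith)
      have h2 : ⌈x ^ (1 - ε)⌉₊ ≤ 1 := by
        have := Nat.ceil_le_ceil h1
        rwa [Nat.ceil_one] at this
      exact Finset.Ico_eq_empty_of_le h2
    rw [hempty, Finset.filter_empty, Finset.sum_empty, Finset.sum_empty, zero_sub]
    have hVx : 0 ≤ densityProd (x ^ γ) * x := mul_nonneg (densityProd_pos _).le (by linarith)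
    have hC : 0 ≤ ((Cf + c₀ * C₄) * Rγ + 1) * ε := by positivity
    rw [mul_neg]
    linarith [mul_nonneg hVx hC]
  -- main case `0 < ε < 1`: parameters
  set ε' : ℝ := ε / 1000 with hε'
  set ε₂ : ℝ := ε / 4 with hε₂
  have hε'0 : 0 < ε' := by positivity
  have hε'ε : ε' ≤ ε / 1000 := le_rfl
  have hε₂0 : 0 < ε₂ := by positivity
  have hε₂3 : ε₂ < 1 / 3 := by rw [hε₂]; linarith
  obtain ⟨C₁, hC₁⟩ := h1c ε' hε'0
  have hC₁0 : 0 ≤ C₁ := prop1_corollary_const_nonneg hC₁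
  set Nx : ℝ → ℝ := fun x => max (x ^ (1 / 15 - ε')) 2 with hNx
  set Mi : ℝ → ℕ → ℝ := fun x i => max (x ^ (1 - 4 * ε') / 2 ^ (i + 1)) 2 with hMi
  have hNx1 : ∀ x, 1 < Nx x := fun x => lt_of_lt_of_le one_lt_two (le_max_right _ _)
  have hMi1 : ∀ x i, 1 < Mi x i := fun x i => lt_of_lt_of_le one_lt_two (le_max_right _ _)
  -- Lemma 2's coefficients for every `(x, i)`
  choose Lc _au _bu al bl hLc _hau _hbu hal hbl Hq using
    fun (x : ℝ) (i : ℕ) => HL2 F f hFf ε₂ (Mi x i) (Nx x) hε₂0 hε₂3 (hMi1 x i) (hNx1 x)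
  set Lmax : ℝ := Real.exp (8 * ε₂⁻¹ ^ 3) with hLmax
  have hLmax0 : 0 ≤ Lmax := (Real.exp_pos _).le
  set B : ℝ := ε₂⁻¹ ^ 8 * Real.exp (K + 9) with hB
  have hB0 : 0 ≤ B := by positivity
  -- largeness conditions on `x`
  have hγ33 : 0 < min γ (1 / 33) := lt_min hγ (by norm_num)
  have EV : ∀ᶠ x : ℝ in atTop,
      2 ≤ x ∧ (2 : ℝ) ≤ x ^ γ ∧ (2 : ℝ) ≤ x ^ (1 / 15 - ε') ∧ (4 : ℝ) ≤ x ^ (ε - 4 * ε') ∧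
      Real.log 2 ≤ ε' * Real.log x ∧
      (∀ t : ℝ, x ^ (min γ (1 / 33)) ≤ t →
        |densityProd t * Real.log t - lambda0| ≤ ε / 8 * lambda0) ∧
      (∀ T : ℝ, 0 < T → Real.log x / 16 ≤ Real.log T →
        B * Real.log T ^ (-(1 / 3 : ℝ)) ≤ 3 * ε / 4) ∧
      (∀ T : Finset ℕ, (∀ q ∈ T, 1 ≤ q ∧ (q : ℝ) < x ∧ q.Coprime (primesProdBelow (x ^ γ))) →
        ∑ q ∈ T, (rho q : ℝ) / q ≤ Rγ) ∧
      ((⌊Real.logb 2 x⌋₊ : ℝ) + 1) ^ 2 * (Lmax * C₁) * x ^ (1 - ε') ≤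
        (ε * (7 / 8 * lambda0) / γ) * x / Real.log x := by
    have e1 := eventually_ge_atTop (2 : ℝ)
    have e2 := (tendsto_rpow_atTop hγ).eventually_ge_atTop (2 : ℝ)
    have e3 := (tendsto_rpow_atTop (show 0 < 1 / 15 - ε' by rw [hε']; linarith)).eventually_ge_atTop (2 : ℝ)
    have e4 := (tendsto_rpow_atTop (show 0 < ε - 4 * ε' by rw [hε']; linarith)).eventually_ge_atTop (4 : ℝ)
    have e5 : ∀ᶠ x : ℝ in atTop, Real.log 2 ≤ ε' * Real.log x :=
      (Real.tendsto_log_atTop.const_mul_atTop hε'0).eventually_ge_atTop _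
    have e7 := eventually_forall_abs_densityProd_mul_log_sub_le
      (show 0 < ε / 8 * lambda0 by have := lambda0_pos; positivity) hγ33
    have e8 := eventually_E_small hB0 (show 0 < 3 * ε / 4 by positivity)
    have e9 := eventually_sum_rough_rho_div_le hγ (by linarith) hM2
    have e10 := eventually_classes_remainder_le (A := Lmax * C₁) (by positivity)
      (show 0 < ε * (7 / 8 * lambda0) / γ by have := lambda0_pos; positivity) hε'0
    filter_upwards [e1, e2, e3, e4, e5, e7, e8, e9, e10] with x h1 h2 h3 h4 h5 h7 h8 h9 h10
    exact ⟨h1, h2, h3, h4, h5, h7, h8, h9, h10⟩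
  obtain ⟨x₀, hx₀⟩ := Filter.eventually_atTop.mp EV
  refine ⟨x₀, fun x hx Z c hZ hc => ?_⟩
  obtain ⟨hx2, hxγ, hxN, hx4, hlog2, hΛ, hE, hR, hrem⟩ := hx₀ x hx
  dsimp only
  set Q := (Finset.Ico 1 ⌈x ^ (1 - ε)⌉₊).filter fun q : ℕ => q.Coprime (primesProdBelow Z)
    with hQ
  -- basic facts about `x`
  have hx1 : 1 < x := by linarith
  have hx0 : 0 < x := by linarith
  set L := Real.log x with hL
  have hL0 : 0 < L := Real.log_pos hx1
  set z := x ^ γ with hz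
  have hz0 : 0 < z := Real.rpow_pos_of_pos hx0 γ
  have hlz : Real.log z = γ * L := Real.log_rpow hx0 γ
  set N := x ^ (1 / 15 - ε') with hN
  have hNx_eq : Nx x = N := max_eq_left hxN
  set D := x ^ (1 - 4 * ε') with hD
  have hD0 : 0 < D := Real.rpow_pos_of_pos hx0 _
  have hxε : x ^ (1 - ε) < x := by
    conv_rhs => rw [← Real.rpow_one x]
    exact Real.rpow_lt_rpow_of_exponent_lt hx1 (by linarith)
  have hxa : x ^ (min γ (1 / 33)) ≤ z :=
    Real.rpow_le_rpow_of_exponent_le hx1.le (min_le_left _ _)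
  -- the level `Z`
  have hZ2 : 2 ≤ Z := hxγ.trans hZ.1
  have hlZ0 : 0 < Real.log Z := Real.log_pos (by linarith)
  -- `Λ` at `z` and at `Z`
  have hΛz := hΛ z hxa
  have hΛZ := hΛ Z (hxa.trans hZ.1)
  set Λz := densityProd z * Real.log z with hΛz_def
  have hΛz_lo : 7 / 8 * lambda0 ≤ Λz := by
    have := (abs_le.mp hΛz).1
    have hε8 : ε / 8 * lambda0 ≤ 1 / 8 * lambda0 :=
      mul_le_mul_of_nonneg_right (by linarith) lambda0_pos.le
    linarith
  have hΛz0 : 0 ≤ Λz := by linarith [hΛz_lo, lambda0_pos]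
  have hΛzZ0 : 0 ≤ Λz / Real.log Z := div_nonneg hΛz0 hlZ0.le
  have hVz : densityProd z = Λz / Real.log z := by
    rw [hΛz_def, hlz]; field_simp
  -- membership facts for `q ∈ Q`
  have hQmem : ∀ q ∈ Q, 1 ≤ q ∧ (q : ℝ) < x ^ (1 - ε) ∧ q.Coprime (primesProdBelow Z) := by
    intro q hq
    rw [hQ, Finset.mem_filter, Finset.mem_Ico] at hq
    exact ⟨hq.1.1, Nat.lt_ceil.mp hq.1.2, hq.2⟩
  -- per-`q` data: the dyadic class
  set iq : ℕ → ℕ := fun q => Nat.log 2 q with hiq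
  -- (d1) dyadic range of `q`
  have hd1 : ∀ q ∈ Q, (2 : ℝ) ^ iq q ≤ q ∧ (q : ℝ) < 2 * 2 ^ iq q := by
    intro q hq
    have hq1 := (hQmem q hq).1
    constructor
    · have := Nat.pow_log_le_self 2 (by omega : q ≠ 0)
      exact_mod_cast this
    · have := Nat.lt_pow_succ_log_self (by norm_num : 1 < 2) q
      have h' : (q : ℝ) < ((2 ^ (Nat.log 2 q + 1) : ℕ) : ℝ) := by exact_mod_cast this
      simpa [pow_succ, mul_comm] using h'
  -- (d2) `Mi x (iq q) = D / 2^{iq+1}` and `q · M ≤ D`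
  have hd2 : ∀ q ∈ Q, Mi x (iq q) = D / 2 ^ (iq q + 1) ∧ (q : ℝ) * Mi x (iq q) ≤ D := by
    intro q hq
    obtain ⟨hq1, hqx, -⟩ := hQmem q hq
    obtain ⟨hlo, hhi⟩ := hd1 q hq
    have hq0 : (0 : ℝ) < q := by exact_mod_cast hq1
    have hpow : (0 : ℝ) < 2 ^ (iq q + 1) := by positivity
    -- `D / 2^{iq+1} ≥ 2`
    have hge2 : (2 : ℝ) ≤ D / 2 ^ (iq q + 1) := by
      rw [le_div_iff₀ hpow]
      have h1 : (2 : ℝ) ^ (iq q + 1) ≤ 2 * q := by rw [pow_succ]; linarith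
      have h2 : 2 * (q : ℝ) * 4 ≤ 2 * x ^ (1 - ε) * x ^ (ε - 4 * ε') := by
        have := mul_le_mul hqx.le hx4 (by norm_num) (by positivity)
        linarith
      have h3 : x ^ (1 - ε) * x ^ (ε - 4 * ε') = D := by
        rw [hD, ← Real.rpow_add hx0]; ring_nf
      have h2' : 2 * (q : ℝ) * 4 ≤ 2 * D := by rw [← h3]; linarith [h2]
      linarith
    have hM : Mi x (iq q) = D / 2 ^ (iq q + 1) := max_eq_left hge2
    refine ⟨hM, ?_⟩
    rw [hM]
    rw [mul_div_assoc', div_le_iff₀ hpow, pow_succ]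
    have h5 := mul_le_mul_of_nonneg_right hhi.le hD0.le
    have e5 : 2 * (2 : ℝ) ^ iq q * D = D * (2 ^ iq q * 2) := by ring
    linarith
  -- (d4) the size of `log(M N)` against `log(y/q)`
  have hd4 : ∀ q ∈ Q, 0 < Mi x (iq q) * Nx x ∧
      Real.log (x ^ (16 / 15 : ℝ) / q) - 6 * ε' * L ≤ Real.log (Mi x (iq q) * Nx x) ∧
      Real.log (Mi x (iq q) * Nx x) ≤ Real.log (x ^ (16 / 15 : ℝ) / q) ∧
      L / 16 ≤ Real.log (Mi x (iq q) * Nx x) := by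
    intro q hq
    obtain ⟨hq1, hqx, -⟩ := hQmem q hq
    obtain ⟨hlo, hhi⟩ := hd1 q hq
    obtain ⟨hM, -⟩ := hd2 q hq
    have hq0 : (0 : ℝ) < q := by exact_mod_cast hq1
    have hpow : (0 : ℝ) < 2 ^ (iq q + 1) := by positivity
    have hMN0 : 0 < Mi x (iq q) * Nx x := mul_pos (by linarith [hMi1 x (iq q)]) (by linarith [hNx1 x])
    refine ⟨hMN0, ?_⟩
    rw [hM, hNx_eq, Real.log_mul (by positivity) (by positivity), Real.log_div hD0.ne' hpow.ne',
      hD, hN, Real.log_rpow hx0, Real.log_rpow hx0, Real.log_pow,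
      Real.log_div (by positivity) hq0.ne', Real.log_rpow hx0]
    -- `iq log 2 ≤ log q < (iq + 1) log 2`
    have hlq_lo : (iq q : ℝ) * Real.log 2 ≤ Real.log q := by
      rw [← Real.log_pow]; exact Real.log_le_log (by positivity) hlo
    have hlq_hi : Real.log q < ((iq q : ℝ) + 1) * Real.log 2 := by
      have := Real.log_lt_log hq0 hhi
      rw [Real.log_mul (by norm_num) (by positivity), Real.log_pow] at this
      linarith
    have hl2 : 0 < Real.log 2 := Real.log_pos (by norm_num)
    have hlogq : Real.log q < (1 - ε) * L := by
      rw [← Real.log_rpow hx0]; exact Real.log_lt_log hq0 hqx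
    have hε'L_eq : ε' * L = ε * L / 1000 := by rw [hε']; ring
    have hεL_lt : ε * L < L := mul_lt_of_lt_one_left hL0 hε1
    have hεL0 : 0 < ε * L := mul_pos hε hL0
    push_cast
    rw [← hL]
    refine ⟨by linarith, by linarith, by linarith⟩
  -- (d6) the class index is at most `⌊log₂ x⌋`
  have hd6 : ∀ q ∈ Q, iq q ≤ ⌊Real.logb 2 x⌋₊ := by
    intro q hq
    obtain ⟨-, hqx, -⟩ := hQmem q hq
    exact le_floor_logb_of_pow_le hx0 ((hd1 q hq).1.trans (hqx.le.trans hxε.le))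
  -- the remainder attached to `q` and the per-`q` inequality
  set RR : ℕ → ℕ → ℕ → ℝ := fun i l q =>
    ∑ m ∈ Finset.Ico 1 ⌈Mi x i⌉₊, ∑ n ∈ Finset.Ico 1 ⌈Nx x⌉₊,
      (if m * n ∣ primesProdBelow Z then al x i l m * bl x i l n * rem x (q * (m * n)) else 0)
    with hRR
  set Rq : ℕ → ℝ := fun q => ∑ l ∈ Finset.range (Lc x (iq q)), RR (iq q) l q with hRq
  set C' : ℝ := Cf + c₀ * C₄ with hC'
  have hC'0 : 0 ≤ C' := by positivity
  -- `q` is *active* when Lemma 2 applies at the level `Z`, i.e. `Z ≤ (MN)^{1/2}`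
  have hkey : ∀ q ∈ Q,
      c q * ((rho q : ℝ) * x / q) * (Λz / Real.log Z) *
          (f (Real.log (x ^ (16 / 15 : ℝ) / q) / Real.log Z) - C' * ε) -
        (if 0 < rho q ∧ Z ≤ (Mi x (iq q) * Nx x) ^ (1 / 2 : ℝ) then c q * Rq q else 0) ≤
      c q * (siftedCount x q Z : ℝ) := by
    intro q hq
    obtain ⟨hq1, hqx, hcop⟩ := hQmem q hq
    have hc0 : 0 ≤ c q := (hc q).1
    rcases Nat.eq_zero_or_pos (rho q) with hρ | hρ
    · rw [siftedCount_eq_zero_of_rho_eq_zero x hρ, if_neg (by omega), hρ]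
      simp
    obtain ⟨hMN0, hMNlo, hMNhi, hMN16⟩ := hd4 q hq
    have hq0' : (0 : ℝ) < q := by exact_mod_cast hq1
    have hX0 : 0 ≤ (rho q : ℝ) * x / q := by positivity
    have hS0 : (0 : ℝ) ≤ c q * (siftedCount x q Z : ℝ) := by positivity
    by_cases hact : Z ≤ (Mi x (iq q) * Nx x) ^ (1 / 2 : ℝ)
    · -- Lemma 2, lower bound, at the level `Z`
      rw [if_pos ⟨hρ, hact⟩]
      have H := (Hq x (iq q) x q hx0 (by omega) hρ Z hZ2 hact hcop).2
      dsimp only at H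
      -- main term and `E`
      have hmain := main_term_lower hFf hγ hγ2 hLip hfmax hε hε1.le hε'0.le hε'ε hx1 hZ
        ⟨hq1, hqx⟩ hMN0 hact ⟨hMNlo, hMNhi⟩ hΛZ hΛz
      have hu : Z = min Z ((Mi x (iq q) * Nx x) ^ (1 / 2 : ℝ)) := (min_eq_left hact).symm
      have hVle := densityProd_level_le hγ hε hε1.le hε'0.le hε'ε hx1 hZ ⟨hq1, hqx⟩
        ⟨le_rfl, hZ.1⟩ hMN0 hMNlo hu hΛZ hΛz
      have hEle : c₀ * (ε₂ + ε₂⁻¹ ^ 8 * Real.exp (K + 9) *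
          Real.log (Mi x (iq q) * Nx x) ^ (-(1 / 3 : ℝ))) ≤ c₀ * ε := by
        refine mul_le_mul_of_nonneg_left ?_ hc₀.le
        have := hE _ hMN0 hMN16
        rw [hε₂]; linarith
      have hV0 : 0 ≤ densityProd Z := (densityProd_pos _).le
      -- combine: the target main term is below Lemma 2's main term
      have hcomb : ((rho q : ℝ) * x / q) * (Λz / Real.log Z) *
          (f (Real.log (x ^ (16 / 15 : ℝ) / q) / Real.log Z) - C' * ε) ≤
          densityProd Z * ((rho q : ℝ) * x / q) *
            (f (Real.log (Mi x (iq q) * Nx x) / Real.log Z) -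
              c₀ * (ε₂ + ε₂⁻¹ ^ 8 * Real.exp (K + 9) *
                Real.log (Mi x (iq q) * Nx x) ^ (-(1 / 3 : ℝ)))) := by
        have h1 : Λz / Real.log Z * (f (Real.log (x ^ (16 / 15 : ℝ) / q) / Real.log Z) - Cf * ε) -
            Λz / Real.log Z * C₄ * (c₀ * ε) ≤
            densityProd Z * f (Real.log (Mi x (iq q) * Nx x) / Real.log Z) -
              densityProd Z * (c₀ * ε) :=
          sub_le_sub hmain (mul_le_mul_of_nonneg_right hVle (by positivity))
        have h2 : densityProd Z * f (Real.log (Mi x (iq q) * Nx x) / Real.log Z) -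
              densityProd Z * (c₀ * ε) ≤
            densityProd Z * (f (Real.log (Mi x (iq q) * Nx x) / Real.log Z) -
              c₀ * (ε₂ + ε₂⁻¹ ^ 8 * Real.exp (K + 9) *
                Real.log (Mi x (iq q) * Nx x) ^ (-(1 / 3 : ℝ)))) := by
          rw [mul_sub]; exact sub_le_sub le_rfl (mul_le_mul_of_nonneg_left hEle hV0)
        have h3 := mul_le_mul_of_nonneg_left (h1.trans h2) hX0
        have e : (rho q : ℝ) * x / q * (Λz / Real.log Z *
            (f (Real.log (x ^ (16 / 15 : ℝ) / q) / Real.log Z) - Cf * ε) -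
              Λz / Real.log Z * C₄ * (c₀ * ε)) =
            (rho q : ℝ) * x / q * (Λz / Real.log Z) *
              (f (Real.log (x ^ (16 / 15 : ℝ) / q) / Real.log Z) - C' * ε) := by
          rw [hC']; ring
        calc _ = _ := e.symm
          _ ≤ _ := h3
          _ = _ := by ring
      calc c q * ((rho q : ℝ) * x / q) * (Λz / Real.log Z) *
              (f (Real.log (x ^ (16 / 15 : ℝ) / q) / Real.log Z) - C' * ε) - c q * Rq q
          = c q * (((rho q : ℝ) * x / q) * (Λz / Real.log Z) *
              (f (Real.log (x ^ (16 / 15 : ℝ) / q) / Real.log Z) - C' * ε)) - c q * Rq q := by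
            ring
        _ ≤ c q * (densityProd Z * ((rho q : ℝ) * x / q) *
            (f (Real.log (Mi x (iq q) * Nx x) / Real.log Z) -
              c₀ * (ε₂ + ε₂⁻¹ ^ 8 * Real.exp (K + 9) *
                Real.log (Mi x (iq q) * Nx x) ^ (-(1 / 3 : ℝ))))) - c q * Rq q :=
            sub_le_sub_right (mul_le_mul_of_nonneg_left hcomb hc0) _
        _ = c q * (densityProd Z * ((rho q : ℝ) * x / q) *
            (f (Real.log (Mi x (iq q) * Nx x) / Real.log Z) -
              c₀ * (ε₂ + ε₂⁻¹ ^ 8 * Real.exp (K + 9) *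
                Real.log (Mi x (iq q) * Nx x) ^ (-(1 / 3 : ℝ)))) - Rq q) := by ring
        _ ≤ c q * (siftedCount x q Z : ℝ) := mul_le_mul_of_nonneg_left H hc0
    · -- `Z > (MN)^{1/2}`: the main term is nonpositive
      rw [if_neg (fun h => hact h.2), sub_zero]
      have hlt : (Mi x (iq q) * Nx x) ^ (1 / 2 : ℝ) < Z := lt_of_not_ge hact
      have htriv := main_term_lower_trivial hFf hγ hγ2 hLip hfmax hε hε1.le hε'0.le hε'ε hx1 hZ
        ⟨hq1, hqx⟩ hMN0 hlt hMNlo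
      have hle : Λz / Real.log Z * (f (Real.log (x ^ (16 / 15 : ℝ) / q) / Real.log Z) - C' * ε) ≤
          Λz / Real.log Z * (f (Real.log (x ^ (16 / 15 : ℝ) / q) / Real.log Z) - Cf * ε) := by
        refine mul_le_mul_of_nonneg_left (sub_le_sub_left ?_ _) hΛzZ0
        refine mul_le_mul_of_nonneg_right ?_ hε.le
        rw [hC']; linarith [mul_nonneg hc₀.le hC₄0.le]
      have hneg : Λz / Real.log Z *
          (f (Real.log (x ^ (16 / 15 : ℝ) / q) / Real.log Z) - C' * ε) ≤ 0 := hle.trans htriv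
      calc c q * ((rho q : ℝ) * x / q) * (Λz / Real.log Z) *
              (f (Real.log (x ^ (16 / 15 : ℝ) / q) / Real.log Z) - C' * ε)
          = c q * ((rho q : ℝ) * x / q) * (Λz / Real.log Z *
              (f (Real.log (x ^ (16 / 15 : ℝ) / q) / Real.log Z) - C' * ε)) := by ring
        _ ≤ 0 := mul_nonpos_of_nonneg_of_nonpos (mul_nonneg hc0 hX0) hneg
        _ ≤ c q * (siftedCount x q Z : ℝ) := hS0
  -- sum the main terms
  have hmainsum : ∑ q ∈ Q, c q * ((rho q : ℝ) * x / q) * (Λz / Real.log Z) *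
      (f (Real.log (x ^ (16 / 15 : ℝ) / q) / Real.log Z) - C' * ε) =
      densityProd z * x * ∑ q ∈ Q, c q * (rho q : ℝ) / q *
        f (Real.log (x ^ (16 / 15 : ℝ) / q) / Real.log Z) * (Real.log z / Real.log Z) -
      densityProd z * x * (C' * ε) * ∑ q ∈ Q, c q * (rho q : ℝ) / q * (Real.log z / Real.log Z) := by
    rw [Finset.mul_sum, Finset.mul_sum, ← Finset.sum_sub_distrib]
    refine Finset.sum_congr rfl fun q hq => ?_
    rw [hVz]
    have hlz0 : Real.log z ≠ 0 := by rw [hlz]; positivity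
    have hlZ0' : Real.log Z ≠ 0 := hlZ0.ne'
    have hq0 : (q : ℝ) ≠ 0 := by have := (hQmem q hq).1; positivity
    field_simp
    try ring
  -- the density sum is `O_γ(1)`
  have hdens : ∑ q ∈ Q, c q * (rho q : ℝ) / q * (Real.log z / Real.log Z) ≤ Rγ := by
    have h1 : ∀ q ∈ Q, c q * (rho q : ℝ) / q * (Real.log z / Real.log Z) ≤ (rho q : ℝ) / q := by
      intro q _
      have hlzZ : Real.log z ≤ Real.log Z := Real.log_le_log hz0 hZ.1
      have hlz0 : 0 < Real.log z := by rw [hlz]; positivity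
      have hratio : Real.log z / Real.log Z ≤ 1 := (div_le_one (by linarith)).mpr hlzZ
      have hρq : 0 ≤ (rho q : ℝ) / q := by positivity
      have hr0 : 0 ≤ Real.log z / Real.log Z := div_nonneg hlz0.le (by linarith)
      calc c q * (rho q : ℝ) / q * (Real.log z / Real.log Z)
          = c q * (Real.log z / Real.log Z) * ((rho q : ℝ) / q) := by ring
        _ ≤ 1 * 1 * ((rho q : ℝ) / q) := by
            refine mul_le_mul_of_nonneg_right ?_ hρq
            exact mul_le_mul (hc q).2 hratio hr0 zero_le_one
        _ = (rho q : ℝ) / q := by ring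
    refine (Finset.sum_le_sum h1).trans (hR Q fun q hq => ?_)
    obtain ⟨hq1, hqx, hcop⟩ := hQmem q hq
    exact ⟨hq1, hqx.trans hxε, Nat.Coprime.coprime_dvd_right (primesProdBelow_dvd_of_le hZ.1) hcop⟩
  -- the remainder sum is `≤ ε V(z) x`
  have hremsum : ∑ q ∈ Q, (if 0 < rho q ∧ Z ≤ (Mi x (iq q) * Nx x) ^ (1 / 2 : ℝ)
      then c q * Rq q else 0) ≤ ε * (densityProd z * x) := by
    rw [← Finset.sum_filter]
    set Q' := Q.filter fun q => 0 < rho q ∧ Z ≤ (Mi x (iq q) * Nx x) ^ (1 / 2 : ℝ) with hQ'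
    have hQ'sub : Q' ⊆ Q := Finset.filter_subset _ _
    set Kset := Q'.image iq with hKset
    rw [← Finset.sum_fiberwise_of_maps_to (s := Q') (t := Kset) (g := iq)
      (fun q hq => Finset.mem_image_of_mem iq hq)]
    -- each class contributes at most `Lmax C₁ x^{1−ε'}`
    have hclass : ∀ k ∈ Kset, ∑ q ∈ Q'.filter (fun q => iq q = k), c q * Rq q ≤
        Lmax * C₁ * x ^ (1 - ε') := by
      intro k _
      set T := Q'.filter (fun q => iq q = k) with hT
      have hTmem : ∀ q ∈ T, q ∈ Q ∧ iq q = k := by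
        intro q hq
        rw [hT, Finset.mem_filter, hQ', Finset.mem_filter] at hq
        exact ⟨hq.1.1, hq.2⟩
      -- rewrite `Rq q` on the fiber through `k`
      have hRq_eq : ∀ q ∈ T, Rq q = ∑ l ∈ Finset.range (Lc x k), RR k l q := by
        intro q hq
        obtain ⟨-, hi⟩ := hTmem q hq
        simp only [hRq, hi]
      rw [show ∑ q ∈ T, c q * Rq q = ∑ q ∈ T, c q * ∑ l ∈ Finset.range (Lc x k), RR k l q
        from Finset.sum_congr rfl fun q hq => by rw [hRq_eq q hq]]
      -- swap `q` and `l`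
      rw [show ∑ q ∈ T, c q * ∑ l ∈ Finset.range (Lc x k), RR k l q =
          ∑ l ∈ Finset.range (Lc x k), ∑ q ∈ T, c q * RR k l q by
        rw [Finset.sum_comm]; exact Finset.sum_congr rfl fun q _ => Finset.mul_sum _ _ _]
      -- each `l` contributes at most `C₁ x^{1−ε'}`
      have hl : ∀ l ∈ Finset.range (Lc x k), ∑ q ∈ T, c q * RR k l q ≤ C₁ * x ^ (1 - ε') := by
        intro l _
        have hT' : ∀ q ∈ T, 0 < q ∧ q.Coprime (primesProdBelow Z) ∧ (q : ℝ) * Mi x k ≤ D := by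
          intro q hq
          obtain ⟨hqQ, hi⟩ := hTmem q hq
          have h2' := (hd2 q hqQ).2
          rw [hi] at h2'
          exact ⟨(hQmem q hqQ).1, (hQmem q hqQ).2.2, h2'⟩
        have habs := abs_remainder_class_le x Z (Mi x k) (Nx x) D T c (al x k l)
          (bl x k l) hT' (fun q => abs_le.mpr ⟨by linarith [(hc q).1], (hc q).2⟩) (hal x k l)
        obtain ⟨hb1, hb2⟩ := indicator_coeff_admissible Z (hbl x k l)
        have hcor := hC₁ x _ hx2 hb1 hb2
        rw [← hN, ← hNx_eq] at hcor
        exact (le_abs_self _).trans (habs.trans hcor)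
      calc ∑ l ∈ Finset.range (Lc x k), ∑ q ∈ T, c q * RR k l q
          ≤ ∑ l ∈ Finset.range (Lc x k), C₁ * x ^ (1 - ε') := Finset.sum_le_sum hl
        _ = (Lc x k : ℝ) * (C₁ * x ^ (1 - ε')) := by
            rw [Finset.sum_const, Finset.card_range, nsmul_eq_mul]
        _ ≤ Lmax * (C₁ * x ^ (1 - ε')) := mul_le_mul_of_nonneg_right (hLc x k) (by positivity)
        _ = Lmax * C₁ * x ^ (1 - ε') := by ring
    -- number of classes
    have hKcard : (Kset.card : ℝ) ≤ ((⌊Real.logb 2 x⌋₊ : ℝ) + 1) ^ 2 := by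
      have hsub : Kset ⊆ Finset.range (⌊Real.logb 2 x⌋₊ + 1) := by
        intro k hk
        obtain ⟨q, hq, rfl⟩ := Finset.mem_image.mp hk
        rw [Finset.mem_range]
        exact Nat.lt_succ_of_le (hd6 q (hQ'sub hq))
      have := Finset.card_le_card hsub
      rw [Finset.card_range] at this
      have h' : (Kset.card : ℝ) ≤ ((⌊Real.logb 2 x⌋₊ + 1 : ℕ) : ℝ) := by exact_mod_cast this
      push_cast at h'
      have h1 : (1 : ℝ) ≤ (⌊Real.logb 2 x⌋₊ : ℝ) + 1 := by
        have : (0 : ℝ) ≤ (⌊Real.logb 2 x⌋₊ : ℝ) := Nat.cast_nonneg _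
        linarith
      calc (Kset.card : ℝ) ≤ (⌊Real.logb 2 x⌋₊ : ℝ) + 1 := h'
        _ = ((⌊Real.logb 2 x⌋₊ : ℝ) + 1) * 1 := by ring
        _ ≤ ((⌊Real.logb 2 x⌋₊ : ℝ) + 1) * ((⌊Real.logb 2 x⌋₊ : ℝ) + 1) :=
            mul_le_mul_of_nonneg_left h1 (by linarith)
        _ = ((⌊Real.logb 2 x⌋₊ : ℝ) + 1) ^ 2 := by ring
    calc ∑ k ∈ Kset, ∑ q ∈ Q'.filter (fun q => iq q = k), c q * Rq q
        ≤ ∑ k ∈ Kset, Lmax * C₁ * x ^ (1 - ε') := Finset.sum_le_sum hclass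
      _ = (Kset.card : ℝ) * (Lmax * C₁ * x ^ (1 - ε')) := by rw [Finset.sum_const, nsmul_eq_mul]
      _ ≤ ((⌊Real.logb 2 x⌋₊ : ℝ) + 1) ^ 2 * (Lmax * C₁ * x ^ (1 - ε')) :=
          mul_le_mul_of_nonneg_right hKcard (by positivity)
      _ = ((⌊Real.logb 2 x⌋₊ : ℝ) + 1) ^ 2 * (Lmax * C₁) * x ^ (1 - ε') := by ring
      _ ≤ (ε * (7 / 8 * lambda0) / γ) * x / Real.log x := hrem
      _ ≤ ε * (densityProd z * x) := by
          rw [hVz, hlz, div_le_iff₀ hL0]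
          have : ε * (7 / 8 * lambda0) / γ * x = ε * ((7 / 8 * lambda0) / (γ * L) * x) * L := by
            field_simp
          rw [this]
          refine mul_le_mul_of_nonneg_right (mul_le_mul_of_nonneg_left ?_ hε.le) hL0.le
          exact mul_le_mul_of_nonneg_right (div_le_div_of_nonneg_right hΛz_lo (by positivity)) hx0.le
  -- conclusion
  have htotal := Finset.sum_le_sum hkey
  rw [Finset.sum_sub_distrib, hmainsum] at htotal
  have hVx : 0 ≤ densityProd z * x := mul_nonneg (densityProd_pos _).le hx0.le
  have hA : densityProd z * x * (C' * ε) * ∑ q ∈ Q, c q * (rho q : ℝ) / q * (Real.log z / Real.log Z) ≤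
      densityProd z * x * (C' * ε) * Rγ :=
    mul_le_mul_of_nonneg_left hdens (mul_nonneg hVx (mul_nonneg hC'0 hε.le))
  calc densityProd z * x * (∑ q ∈ Q, c q * (rho q : ℝ) / q *
          f (Real.log (x ^ (16 / 15 : ℝ) / q) / Real.log Z) * (Real.log z / Real.log Z) -
        ((Cf + c₀ * C₄) * Rγ + 1) * ε)
      = densityProd z * x * ∑ q ∈ Q, c q * (rho q : ℝ) / q *
          f (Real.log (x ^ (16 / 15 : ℝ) / q) / Real.log Z) * (Real.log z / Real.log Z) -
        densityProd z * x * (C' * ε) * Rγ - ε * (densityProd z * x) := by rw [hC']; ring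
    _ ≤ densityProd z * x * ∑ q ∈ Q, c q * (rho q : ℝ) / q *
          f (Real.log (x ^ (16 / 15 : ℝ) / q) / Real.log Z) * (Real.log z / Real.log Z) -
        densityProd z * x * (C' * ε) *
          ∑ q ∈ Q, c q * (rho q : ℝ) / q * (Real.log z / Real.log Z) -
        ∑ q ∈ Q, (if 0 < rho q ∧ Z ≤ (Mi x (iq q) * Nx x) ^ (1 / 2 : ℝ)
          then c q * Rq q else 0) := by linarith [hA, hremsum]
    _ ≤ ∑ q ∈ Q, c q * (siftedCount x q Z : ℝ) := htotal

/-! ### Assembly: Proposition 2, (2) and parity.S19 from Lemma 2 and Proposition 1 -/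

/-- **Proposition 2 (upper bound) from Lemma 2 and Proposition 1 — PROVED** (the Corollary of
Proposition 1 by `proposition1_corollary_of`, the Mertens inputs by `rho_sieveConditionOne` and
`exists_sum_rho_div_filter_le`). [cite: IwaniecInventiones1978, Proposition 2] -/
theorem proposition2_upper_of_lemma2_of_proposition1 (h2 : lemma2_bilinearSieve)
    (h1 : proposition1) : proposition2_upper :=
  proposition2_upper_of h2 (proposition1_corollary_of h1) rho_sieveConditionOne
    exists_sum_rho_div_filter_le

/-- **Proposition 2 (lower bound, constant level) from Lemma 2 and Proposition 1 — PROVED.**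
[cite: IwaniecInventiones1978, Proposition 2] -/
theorem proposition2_lower_const_of_lemma2_of_proposition1 (h2 : lemma2_bilinearSieve)
    (h1 : proposition1) : proposition2_lower_const :=
  proposition2_lower_const_of h2 (proposition1_corollary_of h1) rho_sieveConditionOne
    exists_sum_rho_div_filter_le

/-- **Display (2) of Iwaniec 1978 (p. 173, `z = x^{1/5}`) from Lemma 2 and Proposition 1 —
PROVED** (via both halves of Proposition 2, the §6 evaluation of `IwaniecAlmostPrimesWeightedSum`
and the numerical inequality `IsLinearSieveFunctions.numerics`).
[cite: IwaniecInventiones1978, §2 (2) and §6 p. 187] -/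
theorem weightedSum_lower_of_lemma2_of_proposition1 (h2 : lemma2_bilinearSieve)
    (h1 : proposition1) : weightedSum_lower :=
  weightedSum_lower_of_prop2_of_numerics'_const (proposition2_upper_of_lemma2_of_proposition1 h2 h1)
    (proposition2_lower_const_of_lemma2_of_proposition1 h2 h1) fun _ _ h => h.numerics

/-- **parity.S19 from Iwaniec's Lemma 2 and Proposition 1 — PROVED:** `Ω(n² + 1) ≤ 2` for
infinitely many `n` (`Literature.NumberTheory.Sieve.setOf_isAtMostAlmostPrime_two_sq_add_one_infinite`),
given the linear sieve with the bilinear form of the remainder term (`lemma2_bilinearSieve`,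
Acta Arith. 37 (1980), Theorem 1) and the dispersion estimate `proposition1` (p. 176).
[cite: IwaniecInventiones1978, Theorem p. 172] -/
theorem setOf_isAtMostAlmostPrime_two_sq_add_one_infinite_of_lemma2_of_proposition1
    (h2 : lemma2_bilinearSieve) (h1 : proposition1) :
    setOf_isAtMostAlmostPrime_two_sq_add_one_infinite :=
  setOf_isAtMostAlmostPrime_two_sq_add_one_infinite_of_weightedSum_lower
    (weightedSum_lower_of_lemma2_of_proposition1 h2 h1)

end Literature.NumberTheory.Sieve.Iwaniec1978

end
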